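import Literature.Computation.Certificates.GramSOSList

/-!
# Gram-form SOS certificates on list carriers: a MONOMIAL-WINDOWED residual (one `decide` per window)

Compute-infrastructure companion of `GramSOSList.lean` (ladder GRIDFUSION, lead RULING 6k 2026-08-27,
lane «X3 windowed residual»). There the FREE Gram block of a Positivstellensatz identity
`p = σ₀ + Σᵢ gᵢ σᵢ + Σⱼ hⱼ tⱼ` [cite: BlekhermanParriloThomas2012, Thm 3.127] is split into row
ranges (`GramL.ChunkEqs`) but the residual zero test `Poly.residualL` stays ONE `decide +kernel` —
≈ 260 s of reduction on a degree-4 two-area certificate (gridfusion #50, identity `V̇`: multiplier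
products of 45 × 535 and 670 × 10 terms plus seven partial sums), while one `decide +kernel` of this
shape dies between ≈ 110 s and 150 s («did not reduce to isTrue/isFalse», probe T12, 2026-08-27).
This file makes the RESIDUAL SEPARABLE as well, without shipping any further intermediate:

* `Monomial.wix ws n m = (Σᵢ wᵢ eᵢ) mod (n + 1)` — a CHEAP window index (a few kernel `Nat`
  operations per term, no monomial comparison); its fibres `k = 0 … n` PARTITION all monomials for
  ANY weights (a function's fibres; the producer tunes `ws` offline for balance).
  `Poly.filterW ws n k` keeps window `k` (a filter: sorted lists stay sorted).
* WINDOWED pieces touching only the terms of window `k`: `Poly.mulW` (term-by-list products filtered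
  BEFORE merging), `Poly.mulShortW`, `Poly.sumPolysW` (shipped parts filtered, then merge-sorted),
  `Poly.ineqPartLW` (multiplier products against SHIPPED block polynomials `Gᵢ`), `Poly.eqPartLW`,
  and the windowed residual `Poly.residualLW ws n k`.
* `GramL.GramPolyEqs ineq Gs` — the block polynomials `σᵢ.poly` shipped as literals `Gᵢ` (small) and
  tied to their blocks by one `decide` each (`isZero (normMS Gᵢ − σᵢ.poly)`).
* `Poly.AllWindows P k₀ n` — the nested conjunction of the per-window facts (each typically its own
  file), assembled by `⟨h₀, h₁, …, trivial⟩` like `GramL.ChunkEqs`.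
* (companion file `GramSOSWindowsRows.lean`: the same with the FREE block windowed in the kernel
  row by row — `Poly.gramRowsW`, `Poly.residualL1W`, `Poly.nonneg_of_windowsL1` — so that a fresh
  emission needs neither shipped parts nor `ChunkEqs` files.)
* **`Poly.nonneg_of_windowsL`** — soundness: the hypotheses of `Poly.nonneg_of_chunksL` with its
  single residual fact replaced by one `isZero (residualLW ws n k …)` per window (`AllWindows … 0
  (n + 1)`) and the block-polynomial facts; conclusion `0 ≤ p.eval x` wherever `g ≥ 0` (`g ∈ gs`)
  and `h = 0` (`h ∈ hs`). PROOF = partition additivity of `eval` over the windows for every LEAF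
  (`Poly.sum_eval_filterW`, `Poly.sum_eval_mulW`: windows are applied to leaves and single-term
  products only, never to a merged sum), `eval_mulTerm`, `GramL.ChunkEqs.sum_eq_poly`.
Cost per window ≈ (total merge work)/(number of windows) + one window-index test per leaf term.
Completeness wants trimmed monomials (emitter literals, `Monomial.mul`, `Poly.normMS` all are);
anything else can only make a window test fail, never certify falsely. No new axioms.
References: [cite: BlekhermanParriloThomas2012, Thm 3.39] (Gram form), [cite: BlekhermanParriloThomas2012, Thm 3.127]
(Positivstellensatz certificates), [cite: MartinDorelRoux2017, §3] (data refinement); window partition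
is [folklore]. Not here: no PSD check (any lane), no change to `GramSOSList.lean`, no `native_decide`.
-/

namespace Literature.Computation.Certificates
namespace SOS
open Poly

/-! ### Windows: fibres of a cheap window-index function -/
namespace Monomial
/-- Weighted exponent sum `Σᵢ wᵢ·eᵢ` of a monomial against a weight list. [folklore] -/
def dotW : List ℕ → Monomial → ℕ
  | w :: ws, e :: es => w * e + dotW ws es
  | _, _ => 0

/-- WINDOW INDEX of a monomial: `(Σᵢ wᵢ·eᵢ) mod (n + 1)` (cheap; its fibres `k = 0 … n` partition
ALL monomials for ANY weights — the producer tunes `ws` offline for balance). [folklore] -/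
def wix (ws : List ℕ) (n : ℕ) (m : Monomial) : ℕ := dotW ws m % (n + 1)

/-- A window index never exceeds `n`. [folklore] -/
private theorem wix_le (ws : List ℕ) (n : ℕ) (m : Monomial) : wix ws n m ≤ n :=
  Nat.lt_succ_iff.1 (Nat.mod_lt _ (Nat.succ_pos n))

/-- Hence it lies in `range (n + 1)`. [folklore] -/
private theorem wix_mem_range (ws : List ℕ) (n : ℕ) (m : Monomial) : wix ws n m ∈ Finset.range (n + 1) :=
  Finset.mem_range.2 (Nat.lt_succ_of_le (wix_le ws n m))

end Monomial

namespace Poly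
section Windows
variable {R : Type*} [Field R]
/-- The terms of `p` whose monomial lies in window `k` of the window function `wix ws n`. [folklore] -/
def filterW (ws : List ℕ) (n k : ℕ) (p : Poly) : Poly :=
  p.filter fun t => Monomial.wix ws n t.1 == k

omit [Field R] in
/-- `filterW` on a cons. [folklore] -/
private theorem filterW_cons (ws : List ℕ) (n k : ℕ) (m : Monomial) (c : ℚ) (p : Poly) :
    filterW ws n k ((m, c) :: p) =
      if Monomial.wix ws n m = k then (m, c) :: filterW ws n k p else filterW ws n k p := by
  unfold filterW
  rw [List.filter_cons]
  by_cases h : Monomial.wix ws n m = k <;> simp [h]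

/-- **Partition additivity** (the refinement lemma of the window split): summed over all windows,
the windowed pieces of ANY term list evaluate to the whole list. [cite: MartinDorelRoux2017, §3] -/
theorem sum_eval_filterW (x : ℕ → R) (ws : List ℕ) (n : ℕ) :
    ∀ p : Poly, ∑ k ∈ Finset.range (n + 1), eval x (filterW ws n k p) = eval x p
  | [] => by simp [filterW]
  | (m, c) :: p => by
      have ih := sum_eval_filterW x ws n p
      have step : ∀ k, eval x (filterW ws n k ((m, c) :: p)) =
          (if Monomial.wix ws n m = k then (c : R) * m.eval x else 0) + eval x (filterW ws n k p) := by
        intro k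
        rw [filterW_cons]
        split_ifs <;> simp
      simp only [step, Finset.sum_add_distrib, ih, Finset.sum_ite_eq, Monomial.wix_mem_range,
        if_true, eval_cons]

end Windows

/-! ### Windowed pieces of the residual -/
section WindowedPieces
variable {R : Type*} [Field R] [CharZero R]
/-- Fused windowed term product: the terms of `c·m·q` in window `k` (window tested on the product
monomial before the coefficient is multiplied). [folklore] -/
def mulTermW (ws : List ℕ) (n k : ℕ) (m : Monomial) (c : ℚ) : Poly → Poly
  | [] => []
  | (m', c') :: q =>
    if Monomial.wix ws n (Monomial.mul m m') == k then (Monomial.mul m m', c * c') :: mulTermW ws n k m c q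
    else mulTermW ws n k m c q

omit [Field R] [CharZero R] in
/-- The fused form IS the filtered term product. [folklore] -/
private theorem mulTermW_eq (ws : List ℕ) (n k : ℕ) (m : Monomial) (c : ℚ) :
    ∀ q : Poly, mulTermW ws n k m c q = filterW ws n k (mulTerm m c q)
  | [] => by simp [mulTermW, filterW, mulTerm]
  | (m', c') :: q => by
      have ih := mulTermW_eq ws n k m c q
      simp only [mulTermW, ih, filterW, mulTerm, List.map_cons, List.filter_cons]

/-- Windowed product `p · q`: per term `(m, c)` of `p` the products `c·m·q` landing in window `k`,
merged with the sorted merge (`q` sorted ⇒ linear merges; soundness does not depend on it). [folklore] -/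
def mulW (ws : List ℕ) (n k : ℕ) : Poly → Poly → Poly
  | [], _ => []
  | (m, c) :: p, q => add (mulTermW ws n k m c q) (mulW ws n k p q)

/-- Summed over the windows, the windowed product is the product (refinement lemma). [cite: MartinDorelRoux2017, §3] -/
theorem sum_eval_mulW (x : ℕ → R) (ws : List ℕ) (n : ℕ) (q : Poly) :
    ∀ p : Poly, ∑ k ∈ Finset.range (n + 1), eval x (mulW ws n k p q) = eval x p * eval x q
  | [] => by simp [mulW]
  | (m, c) :: p => by
      have ih := sum_eval_mulW x ws n q p
      simp only [mulW, mulTermW_eq, eval_add, Finset.sum_add_distrib, sum_eval_filterW, ih,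
        eval_mulTerm, eval_cons]
      ring

/-- Windowed product with the SHORTER factor outside (`|p|` merges). [folklore] -/
def mulShortW (ws : List ℕ) (n k : ℕ) (p q : Poly) : Poly :=
  if p.length ≤ q.length then mulW ws n k p q else mulW ws n k q p

/-- Summed over the windows, `mulShortW` is the product (refinement lemma). [cite: MartinDorelRoux2017, §3] -/
theorem sum_eval_mulShortW (x : ℕ → R) (ws : List ℕ) (n : ℕ) (p q : Poly) :
    ∑ k ∈ Finset.range (n + 1), eval x (mulShortW ws n k p q) = eval x p * eval x q := by
  unfold mulShortW
  split_ifs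
  · exact sum_eval_mulW x ws n q p
  · rw [mul_comm]
    simp only [sum_eval_mulW]

/-- Windowed sum of shipped parts: each part is filtered FIRST (a scan), then merge-sorted.
[folklore] -/
def sumPolysW (ws : List ℕ) (n k : ℕ) : List Poly → Poly
  | [] => []
  | P :: Ps => add (normMS (filterW ws n k P)) (sumPolysW ws n k Ps)

/-- Summed over the windows, `sumPolysW` is the sum of the parts (refinement lemma). [cite: MartinDorelRoux2017, §3] -/
theorem sum_eval_sumPolysW (x : ℕ → R) (ws : List ℕ) (n : ℕ) :
    ∀ Ps : List Poly, ∑ k ∈ Finset.range (n + 1), eval x (sumPolysW ws n k Ps) =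
      (Ps.map (eval x)).sum
  | [] => by simp [sumPolysW]
  | P :: Ps => by
      have ih := sum_eval_sumPolysW x ws n Ps
      simp only [sumPolysW, eval_add, eval_normMS, Finset.sum_add_distrib, sum_eval_filterW, ih,
        List.map_cons, List.sum_cons]

/-- Windowed inequality part `Σᵢ gᵢ · Gᵢ` against SHIPPED block polynomials `Gᵢ` (by position,
stopping at the shorter list like `ineqPartL`; both factors merge-sort normalised).
[cite: BlekhermanParriloThomas2012, Thm 3.127] -/
def ineqPartLW (ws : List ℕ) (n k : ℕ) : List Poly → List Poly → Poly
  | g :: gs, G :: Gs => add (mulShortW ws n k (normMS G) (normMS g)) (ineqPartLW ws n k gs Gs)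
  | _, _ => []

/-- The value `Σᵢ Gᵢ(x)·gᵢ(x)` (by position, shorter list wins). [folklore] -/
def ineqVal (x : ℕ → R) : List Poly → List Poly → R
  | g :: gs, G :: Gs => eval x G * eval x g + ineqVal x gs Gs
  | _, _ => 0

/-- Summed over the windows, `ineqPartLW` has the value `ineqVal` (refinement lemma). [cite: MartinDorelRoux2017, §3] -/
theorem sum_eval_ineqPartLW (x : ℕ → R) (ws : List ℕ) (n : ℕ) :
    ∀ gs Gs : List Poly, ∑ k ∈ Finset.range (n + 1), eval x (ineqPartLW ws n k gs Gs) =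
      ineqVal x gs Gs
  | [], Gs => by cases Gs <;> simp [ineqPartLW, ineqVal]
  | g :: gs, [] => by simp [ineqPartLW, ineqVal]
  | g :: gs, G :: Gs => by
      have ih := sum_eval_ineqPartLW x ws n gs Gs
      simp only [ineqPartLW, ineqVal, eval_add, Finset.sum_add_distrib, sum_eval_mulShortW,
        eval_normMS, ih]

/-- Windowed equality part `Σⱼ hⱼ · tⱼ` (by position, both factors normalised).
[cite: BlekhermanParriloThomas2012, Thm 3.127] -/
def eqPartLW (ws : List ℕ) (n k : ℕ) : List Poly → List Poly → Poly
  | h :: hs, t :: ts => add (mulShortW ws n k (normMS h) (normMS t)) (eqPartLW ws n k hs ts)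
  | _, _ => []

/-- The value `Σⱼ hⱼ(x)·tⱼ(x)` (by position). [folklore] -/
def eqVal (x : ℕ → R) : List Poly → List Poly → R
  | h :: hs, t :: ts => eval x h * eval x t + eqVal x hs ts
  | _, _ => 0

/-- Summed over the windows, `eqPartLW` has the value `eqVal` (refinement lemma). [cite: MartinDorelRoux2017, §3] -/
theorem sum_eval_eqPartLW (x : ℕ → R) (ws : List ℕ) (n : ℕ) :
    ∀ hs ts : List Poly, ∑ k ∈ Finset.range (n + 1), eval x (eqPartLW ws n k hs ts) =
      eqVal x hs ts
  | [], ts => by cases ts <;> simp [eqPartLW, eqVal]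
  | h :: hs, [] => by simp [eqPartLW, eqVal]
  | h :: hs, t :: ts => by
      have ih := sum_eval_eqPartLW x ws n hs ts
      simp only [eqPartLW, eqVal, eval_add, Finset.sum_add_distrib, sum_eval_mulShortW,
        eval_normMS, ih]

omit [CharZero R] in
/-- The equality value vanishes wherever every `hⱼ(x) = 0` (the equality part of a Positivstellensatz
certificate on the variety). [cite: BlekhermanParriloThomas2012, Thm 3.127] -/
theorem eqVal_eq_zero (x : ℕ → R) :
    ∀ hs ts : List Poly, (∀ h ∈ hs, eval x h = 0) → eqVal x hs ts = 0
  | [], ts, _ => by cases ts <;> simp [eqVal]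
  | h :: hs, [], _ => by simp [eqVal]
  | h :: hs, t :: ts, hh => by
      rw [eqVal, hh h List.mem_cons_self, zero_mul, zero_add]
      exact eqVal_eq_zero x hs ts fun h' hh' => hh h' (List.mem_cons_of_mem _ hh')

/-- **Windowed residual** of window `k`: the window-`k` terms of
`p − (Σ_t P_t + Σᵢ gᵢ Gᵢ + Σⱼ hⱼ tⱼ)`, every leaf filtered before any merge.
[cite: BlekhermanParriloThomas2012, Thm 3.127] -/
def residualLW (ws : List ℕ) (n k : ℕ) (p : Poly) (gs hs parts Gs ts : List Poly) : Poly :=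
  add (normMS (filterW ws n k p))
    (neg (add (sumPolysW ws n k parts) (add (ineqPartLW ws n k gs Gs) (eqPartLW ws n k hs ts))))

/-- Summed over the windows, the windowed residuals evaluate to the full residual value (refinement
lemma). [cite: MartinDorelRoux2017, §3] -/
theorem sum_eval_residualLW (x : ℕ → R) (ws : List ℕ) (n : ℕ) (p : Poly)
    (gs hs parts Gs ts : List Poly) :
    ∑ k ∈ Finset.range (n + 1), eval x (residualLW ws n k p gs hs parts Gs ts) =
      eval x p - ((parts.map (eval x)).sum + ineqVal x gs Gs + eqVal x hs ts) := by
  simp only [residualLW, eval_add, eval_neg, eval_normMS, Finset.sum_add_distrib,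
    Finset.sum_neg_distrib, sum_eval_filterW, sum_eval_sumPolysW, sum_eval_ineqPartLW,
    sum_eval_eqPartLW]
  ring

end WindowedPieces

/-! ### One fact per window, assembled -/
/-- `AllWindows P k₀ n` = `P k₀ ∧ P (k₀+1) ∧ … ∧ P (k₀+n−1)` — one conjunct per window, each
typically ONE `decide +kernel` in its own file, assembled by `⟨h₀, h₁, …, trivial⟩`. [folklore] -/
def AllWindows (P : ℕ → Prop) : ℕ → ℕ → Prop
  | _, 0 => True
  | k, n + 1 => P k ∧ AllWindows P (k + 1) n

/-- Every window in range satisfies the assembled property. [folklore] -/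
private theorem AllWindows.forall {P : ℕ → Prop} : ∀ {k n : ℕ}, AllWindows P k n → ∀ i, i < n → P (k + i)
  | _, 0, _, _, hi => absurd hi (Nat.not_lt_zero _)
  | k, n + 1, h, i, hi => by
      rcases i with _ | i
      · simpa using h.1
      · have h' := AllWindows.forall h.2 i (Nat.lt_of_succ_lt_succ hi)
        have e : k + (i + 1) = k + 1 + i := by omega
        rw [e]
        exact h'

end Poly

/-! ### Shipped block polynomials -/
namespace GramL
/-- **Block-polynomial equalities**: `Gs = [G₁, G₂, …]` ARE the Gram polynomials `σᵢ.poly` of the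
multiplier blocks (by position, exact length match; one `decide +kernel` each:
`isZero (normMS Gᵢ − σᵢ.poly) = true`). [cite: BlekhermanParriloThomas2012, Thm 3.39] -/
def GramPolyEqs : List GramL → List Poly → Prop
  | σ :: σs, G :: Gs => isZero (Poly.add (Poly.normMS G) (Poly.neg σ.poly)) = true ∧ GramPolyEqs σs Gs
  | [], [] => True
  | [], _ :: _ => False
  | _ :: _, [] => False

section Ordered
variable {R : Type*} [Field R] [LinearOrder R] [IsStrictOrderedRing R]
/-- With the block-polynomial equalities, `QuadNonneg` of every block and `g ≥ 0` for the paired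
hypotheses, the positional value `Σᵢ Gᵢ(x)·gᵢ(x)` is nonnegative.
[cite: BlekhermanParriloThomas2012, Thm 3.127] -/
theorem ineqVal_nonneg (x : ℕ → R) : ∀ (gs : List Poly) (ineq : List GramL) (Gs : List Poly),
    GramPolyEqs ineq Gs → (∀ σ ∈ ineq, σ.toGramSOS.QuadNonneg R) → (∀ g ∈ gs, 0 ≤ Poly.eval x g) →
      0 ≤ Poly.ineqVal x gs Gs
  | [], ineq, Gs, _, _, _ => by cases Gs <;> simp [Poly.ineqVal]
  | g :: gs, [], [], _, _, _ => by simp [Poly.ineqVal]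
  | _ :: _, [], _ :: _, h, _, _ => by simp [GramPolyEqs] at h
  | _ :: _, _ :: _, [], h, _, _ => by simp [GramPolyEqs] at h
  | g :: gs, σ :: σs, G :: Gs, h, hσ, hg => by
      simp only [GramPolyEqs] at h
      have e := Poly.eval_eq_zero_of_isZero x h.1
      rw [Poly.eval_add, Poly.eval_normMS, Poly.eval_neg] at e
      have hG : Poly.eval x G = Poly.eval x σ.poly := by linear_combination e
      rw [Poly.ineqVal, hG]
      exact add_nonneg
        (mul_nonneg (σ.eval_poly_nonneg_of_quadNonneg (hσ σ List.mem_cons_self) x)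
          (hg g List.mem_cons_self))
        (ineqVal_nonneg x gs σs Gs h.2 (fun σ' h' => hσ σ' (List.mem_cons_of_mem _ h'))
          (fun g' h' => hg g' (List.mem_cons_of_mem _ h')))

end Ordered

end GramL

/-! ### Soundness -/
namespace Poly
section Ordered
variable {R : Type*} [Field R] [LinearOrder R] [IsStrictOrderedRing R]
/-- **Soundness, WINDOWED form.** From: the free block's `Q` has `s` rows and the ranges `ns` tile
them (two `decide`s), the shipped parts are the range polynomials (`GramL.ChunkEqs`, one
`decide +kernel` per range), `QuadNonneg` of the free block and of every multiplier block (any PSD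
lane), the shipped block polynomials (`GramL.GramPolyEqs`, one `decide +kernel` per block), and ONE
zero test per WINDOW of the residual (`AllWindows … 0 (n + 1)`, one `decide +kernel` each) —
conclude `p(x) ≥ 0` wherever `g ≥ 0` (`g ∈ gs`) and `h = 0` (`h ∈ hs`). Same conclusion as
`nonneg_of_chunksL`; the weights `ws` and `n` are arbitrary. [cite: BlekhermanParriloThomas2012, Thm 3.127] -/
theorem nonneg_of_windowsL {p : Poly} {gs hs : List Poly} {free : GramL} {ineq : List GramL}
    {ts parts Gs : List Poly} {ns : List ℕ} {ws : List ℕ} {n : ℕ}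
    (hQ : free.Q.length = free.s) (hcov : free.s ≤ ns.sum) (hparts : free.ChunkEqs 0 ns parts)
    (hf : free.toGramSOS.QuadNonneg R) (hσ : ∀ σ ∈ ineq, σ.toGramSOS.QuadNonneg R)
    (hG : GramL.GramPolyEqs ineq Gs)
    (hW : AllWindows (fun k => isZero (residualLW ws n k p gs hs parts Gs ts) = true) 0 (n + 1))
    (x : ℕ → R) (hg : ∀ g ∈ gs, 0 ≤ eval x g) (hh : ∀ h ∈ hs, eval x h = 0) : 0 ≤ eval x p := by
  have hzero : ∑ k ∈ Finset.range (n + 1), eval x (residualLW ws n k p gs hs parts Gs ts) = 0 := by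
    refine Finset.sum_eq_zero fun k hk => ?_
    have hk' := AllWindows.forall hW k (Finset.mem_range.1 hk)
    simp only [Nat.zero_add] at hk'
    exact eval_eq_zero_of_isZero x hk'
  rw [sum_eval_residualLW, GramL.ChunkEqs.sum_eq_poly free x hQ hcov hparts,
    eqVal_eq_zero x hs ts hh] at hzero
  have h1 := free.eval_poly_nonneg_of_quadNonneg hf x
  have h2 := GramL.ineqVal_nonneg x gs ineq Gs hG hσ hg
  linarith

end Ordered

end Poly

/-! ### Tests / usage templates (kernel-checked) -/
section TestsW
open Poly

/-- Test (two windows, shipped block polynomial): `2a² − 2ab + 2b² ≥ 0` with the free block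
`Q = [[2, -1], [-1, 2]]` in the basis `(a, b)`, parts `P₀ = 2a² − ab`, `P₁ = −ab + 2b²`, no
multipliers; window function `e₀ mod 2` (weights `[1]`, `n = 1`). -/
example (a b : ℝ) : 0 ≤ 2 * a ^ 2 - 2 * a * b + 2 * b ^ 2 := by
  let σ : GramL := ⟨[([1] : List ℕ), ([0, 1] : List ℕ)], [[2, -1], [-1, 2]], [], []⟩
  have hq : σ.toGramSOS.QuadNonneg ℝ :=
    σ.quadNonneg_of_gramCertZ (Arows := [[8, -4], [-4, 8]]) (d := ![2, 1]) (B := !![2, -1; 0, 2])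
      (c := 4) (by decide +kernel) (by norm_num) (by decide +kernel)
  have hparts : σ.ChunkEqs 0 [1, 1]
      [[(([2] : List ℕ), (2 : ℚ)), (([1, 1] : List ℕ), (-1 : ℚ))],
        [(([1, 1] : List ℕ), (-1 : ℚ)), (([0, 2] : List ℕ), (2 : ℚ))]] :=
    ⟨by decide +kernel, by decide +kernel, trivial⟩
  have hW : AllWindows (fun k => isZero (residualLW [1] 1 k
      [(([0, 2] : List ℕ), (2 : ℚ)), (([1, 1] : List ℕ), (-2 : ℚ)), (([2] : List ℕ), (2 : ℚ))] [] []
      [[(([2] : List ℕ), (2 : ℚ)), (([1, 1] : List ℕ), (-1 : ℚ))],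
        [(([1, 1] : List ℕ), (-1 : ℚ)), (([0, 2] : List ℕ), (2 : ℚ))]] [] []) = true) 0 2 :=
    ⟨by decide +kernel, by decide +kernel, trivial⟩
  have h := nonneg_of_windowsL (gs := []) (hs := []) (ineq := []) (ts := []) (Gs := [])
    (p := [(([0, 2] : List ℕ), (2 : ℚ)), (([1, 1] : List ℕ), (-2 : ℚ)), (([2] : List ℕ), (2 : ℚ))])
    (by decide) (by decide) hparts hq (by simp) trivial hW (vars [a, b]) (by simp) (by simp)
  simp only [eval_cons, eval_nil, Monomial.eval_eq, Monomial.evalFrom_cons, Monomial.evalFrom_nil,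
    vars_cons_zero, vars_cons_succ] at h
  push_cast at h
  linarith

/-- Test (one multiplier with a SHIPPED block polynomial, two windows): for `t ≥ 0`,
`t³ − t² + t ≥ 0` from `p = (free: empty) + t · G` with the 2×2 block `Q = [[1, -1/2], [-1/2, 1]]`
in the basis `(1, t)` and its shipped polynomial `G = 1 − t + t²`. -/
example (t : ℝ) (ht : 0 ≤ t) : t ^ 2 ≤ t ^ 3 + t := by
  let σ : GramL := ⟨[([] : List ℕ), ([1] : List ℕ)], [[1, -1 / 2], [-1 / 2, 1]], [1, 7 / 10],
    [[1, -1 / 2], [0, 1]]⟩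
  have hσ : σ.toGramSOS.QuadNonneg ℝ := σ.toGramSOS.quadNonneg_of_valid (by decide +kernel)
  have hG : GramL.GramPolyEqs [σ]
      [[(([] : List ℕ), (1 : ℚ)), (([1] : List ℕ), (-1 : ℚ)), (([2] : List ℕ), (1 : ℚ))]] :=
    ⟨by decide +kernel, trivial⟩
  have hW : AllWindows (fun k => isZero (residualLW [1] 1 k
      [(([1] : List ℕ), (1 : ℚ)), (([2] : List ℕ), (-1 : ℚ)), (([3] : List ℕ), (1 : ℚ))]
      [X 0] [] [] [[(([] : List ℕ), (1 : ℚ)), (([1] : List ℕ), (-1 : ℚ)), (([2] : List ℕ), (1 : ℚ))]]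
      []) = true) 0 2 :=
    ⟨by decide +kernel, by decide +kernel, trivial⟩
  have h := nonneg_of_windowsL (free := ⟨[], [], [], []⟩) (ns := []) (parts := [])
    (p := [(([1] : List ℕ), (1 : ℚ)), (([2] : List ℕ), (-1 : ℚ)), (([3] : List ℕ), (1 : ℚ))])
    (gs := [X 0]) (hs := []) (ts := []) (by decide) (by decide) trivial
    (GramL.quadNonneg_of_nil _ rfl) (by simpa using hσ) hG hW (vars [t]) (by simpa using ht) (by simp)
  simp only [eval_cons, eval_nil, Monomial.eval_eq, Monomial.evalFrom_cons, Monomial.evalFrom_nil,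
    vars_cons_zero] at h
  push_cast at h
  linarith

end TestsW

end SOS

end Literature.Computation.Certificates
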